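import Summits.BirchSwinnertonDyer.BirchSwinnertonDyer.Theorems.SignedLowerHalvesSmallImageLowerHalfBothSignsRttJunctionLocal
import Summits.BirchSwinnertonDyer.BirchSwinnertonDyer.Theorems.SignedLowerHalvesSmallImageLowerHalfBothSignsRttD2FrameRamification
import Summits.BirchSwinnertonDyer.BirchSwinnertonDyer.Theorems.SignedLowerHalvesSmallImageLowerHalfBothSignsRttD2SeqJ3HS2Plumb
import HarnessLib

/-!
# Route `SignedLowerHalves`, crux L `SmallImageLowerHalfBothSigns` (stmt-BirchSwinnertonDyer-23599), line `rtt_w3` v22 — E2, junction row J2⁺ / stub S1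
# (THE LOCAL PACKAGE IN THE FRAME'S VOCABULARY): `E := C(m²) · ∏_{w ∈ S₀K ∖ supp(p𝔣)} ([φ_w] − u_w)` MAPS `𝐇¹` INTO `B′ = JunctionCarrier` (unfolded)

INPUTS hand `bsd-inputs-honda-p1` g26 under LEAD `cruxlead-stmt-BirchSwinnertonDyer-23599` g12 (cell `bsd-ssimc`). Helper `--supports stmt-BirchSwinnertonDyer-23599`. THEOREMS ONLY.
This file discharges, from the clauses the v22 stub `stub_junctionLocal_ns` quantifies over, the hypotheses of `exists_junctionDepletion_smul_mem_strictCarrier` (file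
`…RttJunctionLocal`): `N_P ≤ U_n` (`P = supp(p𝔣)` contains the places above `p`, the `ℤ_p`-extension is unramified elsewhere), the exponent of `θ′` on the inertia at
`w ∤ p` (`hθfin` + `hker`: `θ′ = χ₀` on `Gal(K̄/K̃_∞) ⊇ I_w`), `w ∤ p` for the places `S₀K` above `S₀ ∌ (p)`, finiteness of `S₀K` (-w3's `finite_placesAboveFinset`), and `κ(γ⁻¹) = −1` for a normalised
topological generator `γ`. Result ★★★ `exists_junctionDepletion_smul_mem_strictCarrier_supp`: the first two conjuncts of S1 in STRUCTURAL form (the carrier is -w3's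
`strictCarrier I (strictLevel S κ θ′ (supp p𝔣) S₀K) _`, i.e. the line file's `JunctionCarrier` unfolded). HONEST FRAMING: the Euler identity (third conjunct of S1; print
«strong multiplicity one», RULING «S1-EULER») is NOT treated; E2, crux L, crux M and BSD remain OPEN and are proved for NO curve.
References: [PerrinRiou1994Invent] §1.3; [Rubin2000] Thm. 1.7.3, App. B; [Washington1997] Prop. 13.2; [NeukirchSchmidtWingberg2008] VIII §3, (8.6.2)–(8.6.3).
-/

set_option autoImplicit false
set_option linter.dupNamespace false -- D-0017: single-problem summit, the namespace repeats the problem name by design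
noncomputable section

open scoped Classical
open NumberField IsDedekindDomain Field PowerSeries Rat.HeightOneSpectrum

namespace Summit.BirchSwinnertonDyer.BirchSwinnertonDyer.Theorems.SmallImageRttJunctionLocal

open Literature.NumberTheory.EllipticCurves Literature.NumberTheory.GaloisRepresentations
  Literature.NumberTheory.ComplexMultiplication.EllipticUnits Literature.NumberTheory.ComplexMultiplication.EllipticUnits.JohnsonLeungKings2011
  Summit.BirchSwinnertonDyer.BirchSwinnertonDyer.Theorems.SmallImageRttD2J1 Summit.BirchSwinnertonDyer.BirchSwinnertonDyer.Theorems.SmallImageRttD2Seq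
  Summit.BirchSwinnertonDyer.BirchSwinnertonDyer.Theorems.SmallImageRttD2Twist IsDedekindDomain.HeightOneSpectrum

section Frame

variable {K : Type} [Field K] [NumberField K] {p : ℕ} [Fact p.Prime]

/-- **`N_P ≤ U_n` for every `n`** when `P` contains the places above `p`: a `ℤ_p`-extension is unramified outside `p` (tree `ZpExtension.inertia_le_kerSubgroup_holds`), so `κ` kills the
inertia groups above the places outside `P`, hence `N_P` (`eq_one_of_mem_ramificationSubgroup`), and `ker κ ≤ U_n`. [cite: Washington1997, Prop. 13.2] [cite: NeukirchSchmidtWingberg2008, VIII §3] -/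
theorem ramificationSubgroup_le_layerSubgroup (κ : ZpExtension K p) {P : Set (HeightOneSpectrum (𝓞 K))}
    (hP : ∀ v : HeightOneSpectrum (𝓞 K), ((p : ℕ) : 𝓞 K) ∈ v.asIdeal → v ∈ P) (n : ℕ) : ramificationSubgroup K P ≤ κ.layerSubgroup n := fun _ hσ ↦
  κ.kerSubgroup_le_layerSubgroup n (eq_one_of_mem_ramificationSubgroup P κ.toContinuousMonoidHom
    (fun v hv _ h𝔓 _ hτ ↦ ZpExtension.inertia_le_kerSubgroup_holds K p κ (fun h ↦ hv (hP v h)) h𝔓 hτ) hσ)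

omit [Fact p.Prime] in
/-- The places above `p` lie in `supp(p𝔣)`. [cite: JohnsonLeungKings2011, Cor. 5.3 (S = supp p𝔣)] -/
theorem mem_suppPF_of_natCast_mem (𝔣 : Ideal (𝓞 K)) (v : HeightOneSpectrum (𝓞 K)) (hv : ((p : ℕ) : 𝓞 K) ∈ v.asIdeal) : v ∈ suppPF p 𝔣 := by
  by_contra h
  exact (not_mem_and_not_le_of_not_mem_suppPF (𝔪 := 𝔣) dvd_rfl h).1 hv

/-- **The exponent of `θ′` on the inertia at `w ∤ p`**: if `χ₀^m = 1` and `θ′ = χ₀` on `Gal(K̄/K̃_∞) = pairKer κ₁ κ₂` (which contains every inertia group above `w ∤ p`: both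
`ℤ_p`-extensions are unramified there), then `θ′(τ)^m = 1` for every inertia element `τ` above `w`. [cite: Washington1997, Prop. 13.2] [cite: deShalit1987, II §1.3] -/
theorem apply_pow_eq_one_of_mem_inertia (κ₁ κ₂ : ZpExtension K p) {S : Set (PadicAlgCl p)} {χ₀ θ' : absoluteGaloisGroup K →ₜ* (padicCoeffIntegers S)ˣ} {m : ℕ}
    (hχ₀m : ∀ τ : absoluteGaloisGroup K, χ₀ τ ^ m = 1) (hker : ∀ τ ∈ ZpExtension.pairKer κ₁ κ₂, θ' τ = χ₀ τ)
    {w : HeightOneSpectrum (𝓞 K)} (hwp : ((p : ℕ) : 𝓞 K) ∉ w.asIdeal) :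
    ∀ 𝔓 ∈ w.primesAbove, ∀ τ ∈ 𝔓.inertia (absoluteGaloisGroup K), θ' τ ^ m = 1 := fun 𝔓 h𝔓 τ hτ ↦ by
  rw [hker τ (by rw [ZpExtension.pairKer]; exact ⟨ZpExtension.inertia_le_kerSubgroup_holds K p κ₁ hwp h𝔓 hτ, ZpExtension.inertia_le_kerSubgroup_holds K p κ₂ hwp h𝔓 hτ⟩)]
  exact hχ₀m τ

/-- **Two distinct rational primes do not lie in a common prime of `𝓞 K`** (Bézout). [cite: Lang1990, Ch. 1 §2] -/
theorem natCast_not_mem_of_natCast_mem {w : HeightOneSpectrum (𝓞 K)} {ℓ q : ℕ} (hℓ : ℓ.Prime) (hq : q.Prime) (hne : ℓ ≠ q) (hℓw : (ℓ : 𝓞 K) ∈ w.asIdeal) :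
    (q : 𝓞 K) ∉ w.asIdeal := fun hqw ↦ by
  have hb := Nat.gcd_eq_gcd_ab ℓ q
  rw [Nat.Coprime.gcd_eq_one ((Nat.coprime_primes hℓ hq).mpr hne)] at hb
  have h1 : (1 : 𝓞 K) = (ℓ : 𝓞 K) * (ℓ.gcdA q : 𝓞 K) + (q : 𝓞 K) * (ℓ.gcdB q : 𝓞 K) := by exact_mod_cast congrArg (Int.cast : ℤ → 𝓞 K) hb
  exact w.isPrime.ne_top ((Ideal.eq_top_iff_one _).mpr (h1 ▸ w.asIdeal.add_mem (w.asIdeal.mul_mem_right _ hℓw) (w.asIdeal.mul_mem_right _ hqw)))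

/-- **The places `S₀K` of `K` above a finite set `S₀ ∌ (p)` of rational places are off `p`.** [cite: Lang1990, Ch. 1 §2] -/
theorem natCast_not_mem_of_mem_placesAbove {S₀ : Finset (HeightOneSpectrum (𝓞 ℚ))} (hS₀p : ∀ v ∈ S₀, ((p : ℕ) : 𝓞 ℚ) ∉ v.asIdeal)
    {w : HeightOneSpectrum (𝓞 K)} (hw : w ∈ {w : HeightOneSpectrum (𝓞 K) | ∃ v ∈ S₀, ((natGenerator v : ℕ) : 𝓞 K) ∈ w.asIdeal}) :
    ((p : ℕ) : 𝓞 K) ∉ w.asIdeal := by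
  obtain ⟨v, hv, hℓw⟩ := hw
  refine natCast_not_mem_of_natCast_mem (prime_natGenerator v) Fact.out (fun h ↦ hS₀p v hv ?_) hℓw
  exact (Rat.natCast_mem_asIdeal_iff v).mpr (h ▸ dvd_rfl)

omit [NumberField K] in
/-- `κ(γ⁻¹) = −1` for a normalised topological generator `γ` (`κ γ = 1`). [cite: Washington1997, §13.2] -/
theorem toAdd_apply_inv_of_isTopGenerator {κ : ZpExtension K p} {γ : absoluteGaloisGroup K} (hγ : κ.IsTopGenerator γ) :
    (κ γ⁻¹).toAdd = ((-1 : ℤ_[p]ˣ) : ℤ_[p]) := by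
  rw [map_inv, toAdd_inv, Units.val_neg, Units.val_one]
  exact congrArg (fun t ↦ -Multiplicative.toAdd t) hγ

/-- ★★★ **THE LOCAL PACKAGE IN THE FRAME'S VOCABULARY (first two conjuncts of S1, structural form).** For a `ℤ_p`-extension `κ` of `K` with normalised topological generator
`γ`, a finite set `S₀` of rational places not containing `(p)` with places `S₀K` of `K` above it, a level `𝔣`, characters `χ₀, θ′` with `χ₀^m = 1` and `θ′ = χ₀` on
`Gal(K̄/K̃_∞)` (`hθfin`, `hker` of the frame), and the frame's ramification clause (R) of `CharRoadFrameSupp`: THERE ARE a finite set `T = S₀K ∖ supp(p𝔣)` and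
Frobenius elements `φ_w` (`w ∈ T`) such that **`E := C(m²) · ∏_{w∈T} ((1+T)^{−κ(φ_w)} − C(θ′(φ_w)·χ_cyc(φ_w)))` maps EVERY `b` of EVERY cyclotomic model `I` into
`strictCarrier I (strictLevel S κ θ′ (supp p𝔣) S₀K) _`** (= the line file's `JunctionCarrier`, unfolded). [cite: PerrinRiou1994Invent, §1.3] [cite: Rubin2000, Thm. 1.7.3, App. B.2–B.3] -/
theorem exists_junctionDepletion_smul_mem_strictCarrier_supp (S : Set (PadicAlgCl p)) (κ : ZpExtension K p) {γ : absoluteGaloisGroup K} (hγ : κ.IsTopGenerator γ)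
    (S₀ : Finset (HeightOneSpectrum (𝓞 ℚ))) (hS₀p : ∀ v ∈ S₀, ((p : ℕ) : 𝓞 ℚ) ∉ v.asIdeal) (𝔣 : Ideal (𝓞 K)) (κ₂ : ZpExtension K p)
    {χ₀ : absoluteGaloisGroup K →ₜ* (padicCoeffIntegers S)ˣ} (θ' : absoluteGaloisGroup K →ₜ* (padicCoeffIntegers S)ˣ) {m : ℕ}
    (hχ₀m : ∀ τ : absoluteGaloisGroup K, χ₀ τ ^ m = 1) (hker : ∀ τ ∈ ZpExtension.pairKer κ κ₂, θ' τ = χ₀ τ)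
    (hR : ∀ w ∈ suppPF p 𝔣, ((p : ℕ) : 𝓞 K) ∉ w.asIdeal → ∃ 𝔓 ∈ w.primesAbove, ∃ τ ∈ 𝔓.inertia (absoluteGaloisGroup K), θ' τ ≠ 1)
    (I : CycIwasawaCohomologyDataO S κ γ⁻¹ θ' (suppPF p 𝔣) 1) :
    ∃ (T : Finset (HeightOneSpectrum (𝓞 K))) (φ : HeightOneSpectrum (𝓞 K) → absoluteGaloisGroup K),
      (↑T = {w : HeightOneSpectrum (𝓞 K) | ∃ v ∈ S₀, ((natGenerator v : ℕ) : 𝓞 K) ∈ w.asIdeal} \ suppPF p 𝔣) ∧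
      (∀ w ∈ T, IsArithFrobAt (𝓞 K) (φ w) (adicCompletionPrime K w)) ∧
      (∀ w ∈ T, ∀ n, γ⁻¹ ^ (PadicInt.toZModPow n (-(κ (φ w)).toAdd)).val * (φ w)⁻¹ ∈ κ.layerSubgroup n) ∧
      ∀ b : I.H, (PowerSeries.C ((m : padicCoeffIntegers S) ^ 2) * ∏ w ∈ T, (iwasawaToIwasawaO S (binomialSeries ℤ_[p] (-(κ (φ w)).toAdd)) -
          PowerSeries.C (((θ' (φ w) : (padicCoeffIntegers S)ˣ) : padicCoeffIntegers S) *
            padicIntToCoeffIntegers S ((GaloisRep.cyclotomicCharacter K p (φ w) : ℤ_[p]ˣ) : ℤ_[p])))) • b ∈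
        strictCarrier I (strictLevel S κ θ' (suppPF p 𝔣) {w : HeightOneSpectrum (𝓞 K) | ∃ v ∈ S₀, ((natGenerator v : ℕ) : 𝓞 K) ∈ w.asIdeal})
          (fun n k f _ hy ↦ smul_mem_strictLevel S κ θ' (suppPF p 𝔣) {w : HeightOneSpectrum (𝓞 K) | ∃ v ∈ S₀, ((natGenerator v : ℕ) : 𝓞 K) ∈ w.asIdeal} γ⁻¹ n k f hy) := by
  have hfin : ({w : HeightOneSpectrum (𝓞 K) | ∃ v ∈ S₀, ((natGenerator v : ℕ) : 𝓞 K) ∈ w.asIdeal} \ suppPF p 𝔣).Finite :=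
    (finite_placesAboveFinset S₀).subset Set.sdiff_subset
  obtain ⟨φ, x, hφ, hx, hxdef, hmem⟩ := exists_junctionDepletion_smul_mem_strictCarrier S κ θ' (suppPF p 𝔣) (toAdd_apply_inv_of_isTopGenerator hγ) hfin.toFinset
    (fun w hw ↦ ((hfin.mem_toFinset).mp hw).2) (ramificationSubgroup_le_layerSubgroup κ (mem_suppPF_of_natCast_mem 𝔣))
    ({w : HeightOneSpectrum (𝓞 K) | ∃ v ∈ S₀, ((natGenerator v : ℕ) : 𝓞 K) ∈ w.asIdeal} ∩ suppPF p 𝔣)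
    (fun w hw ↦ natCast_not_mem_of_mem_placesAbove hS₀p hw.1) (fun w hw ↦ hR w hw.2 (natCast_not_mem_of_mem_placesAbove hS₀p hw.1))
    (fun w hw ↦ apply_pow_eq_one_of_mem_inertia κ κ₂ hχ₀m hker (natCast_not_mem_of_mem_placesAbove hS₀p hw.1)) I
  have hxw : ∀ w, x w = -(κ (φ w)).toAdd := fun w ↦ by rw [hxdef, inv_neg, inv_one, Units.val_neg, Units.val_one, neg_one_mul]
  refine ⟨hfin.toFinset, φ, hfin.coe_toFinset, hφ, fun w hw n ↦ hxw w ▸ hx w hw n, fun b ↦ ?_⟩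
  have hsub : {w : HeightOneSpectrum (𝓞 K) | ∃ v ∈ S₀, ((natGenerator v : ℕ) : 𝓞 K) ∈ w.asIdeal} ⊆
      ↑hfin.toFinset ∪ ({w : HeightOneSpectrum (𝓞 K) | ∃ v ∈ S₀, ((natGenerator v : ℕ) : 𝓞 K) ∈ w.asIdeal} ∩ suppPF p 𝔣) := fun w hw ↦ by
    by_cases hwP : w ∈ suppPF p 𝔣
    · exact Or.inr ⟨hw, hwP⟩
    · exact Or.inl (hfin.mem_toFinset.mpr ⟨hw, hwP⟩)
  have h := hmem _ hsub (fun n k f _ hy ↦ smul_mem_strictLevel S κ θ' (suppPF p 𝔣) _ γ⁻¹ n k f hy) b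
  simp only [hxw] at h
  exact h

end Frame

end Summit.BirchSwinnertonDyer.BirchSwinnertonDyer.Theorems.SmallImageRttJunctionLocal

end
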